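import Literature.MathematicalPhysics.QuantumFieldTheory.Balaban1983to89.B5Prop11Plancherel

/-!
# T⁴ programme, spine nodes NE2 × NE3 — THE LATTICE ℓ² → SUP INTERPOLATION UNDER A STEP-LIPSCHITZ BOUND (closer (M1″) of the located gap
# GAPS G-ne2leaf08g2-1 between node NE3's ENERGY deliverable and NE2 tier B's per-bond SUP hypothesis `hNE3`)

NE2 formalisation swarm `b2b-balaban-t4-ne2-formalise-*`, leaf prover 08 (gen 2; rows B7 / B6′ lineage), leaf-proposed support item (CLAIMS.log
2026-08-20 INTENT «(M1″)»).  CONTEXT (GAPS G-ne2leaf08g2-1).  Node NE3's energy-distance root `NE3EnergyShapes.NE3EnergyRate` bounds the ℓ²-ENERGY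
`√(Σ_bonds ‖Z(b)‖² + …)` of the log-direction between the two runs' minimisers, while NE2's ROOT B consumes a PER-BOND SUP two-level consistency of the
connection towers (`NE2FromNE3.consistent_of_localRate_lev`).  From ℓ² alone a sup bound loses the whole rate; WITH a step-Lipschitz bound on the field
(the (3.35)-shape `|∇^ηA| ≤ Λ`, i.e. `λ = Λη` per lattice step) the elementary inequality of this file recovers a sup bound — the consumer optimises the cube
side `r`, giving `sup ≤ C_d·(Λ^d η^d Σ‖f‖²)^{1/(d+2)}` (rate `L^{−kd/(d+2)}` in the gap's bookkeeping).  THIS FILE proves the two-term lattice form, for any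
seminormed group `E`, any torus `Tor N = Π_μ ℤ/N_μ` (`B5Prop11Plancherel.Tor`, `unitVec`), any `f : Tor N → E` with `‖f (x + e_μ) − f x‖ ≤ λ`:
 * `norm_sub_le_of_nsmul_unitVec` (`n` steps in one direction cost `≤ n·λ`), `cubePt x₀ v = x₀ + Σ_μ v_μ • e_μ`, `norm_sub_cubePt_le` (`≤ λ·Σ_μ v_μ`),
   `cubePt_apply`, `cubePt_injOn` (the cube `[0, r]^d` embeds injectively when `r < N_μ` for all `μ`);
 * **`card_mul_sq_le_sum_sq`**: `d·r·λ ≤ ‖f x₀‖` ⟹ `(r+1)^d · (‖f x₀‖ − d·r·λ)² ≤ Σ_x ‖f x‖²`;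
 * **`norm_le_of_stepLipschitz_of_sum_sq`**: `‖f x₀‖ ≤ d·r·λ + √(Σ_x ‖f x‖²) / √((r+1)^d)` for EVERY `r` with `r < N_μ` (all `μ`).

HONEST FRAMING (T4-DAG p. 1).  An elementary lattice inequality ([folklore]); closes NOTHING by itself — the gap's other closers (ROOT B at a general rate
`ρ`, the inter-level gauge statement) remain; nothing of NE2 / NE3 is proved; spine PROVED 0/9 unchanged; NOT infinite volume / mass gap / Clay.  HONEST
DEPENDENCY: continuum YM on T⁴ ⇐ BetaPertH ∧ nine spine estimates (0/9 proved); BetaPertH ⇐ (D1) ∧ (D4) ∧ CAP+tail; G-an2-4 gates asym, D1 and NE2/3/4.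
ABSOLUTE RULE kept; no `def … : Prop` fact; no `sorry`.
-/

noncomputable section

open scoped BigOperators

namespace Summit.QuantumFields.BalabanUV.T4Continuum.LatticeSupFromEnergy

open Literature.MathematicalPhysics.QuantumFieldTheory.Balaban1983to89.B5Prop11Plancherel (Tor unitVec)

variable {d : ℕ} (N : Fin d → ℕ) [hN : ∀ μ, NeZero (N μ)] {E : Type*} [SeminormedAddCommGroup E]

/-! ## §1 Paths: `n` steps in one direction, then a cube diagonal -/

omit hN in
/-- **`n` LATTICE STEPS IN DIRECTION `μ` COST AT MOST `n·λ`.** [folklore] -/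
theorem norm_sub_le_of_nsmul_unitVec (f : Tor N → E) {lam : ℝ} (hlip : ∀ (x : Tor N) (μ : Fin d), ‖f (x + unitVec N μ) - f x‖ ≤ lam)
    (x : Tor N) (μ : Fin d) : ∀ n : ℕ, ‖f (x + n • unitVec N μ) - f x‖ ≤ n * lam
  | 0 => by simp
  | n + 1 => by
    have ih := norm_sub_le_of_nsmul_unitVec f hlip x μ n
    have hstep := hlip (x + n • unitVec N μ) μ
    rw [succ_nsmul, ← add_assoc]
    calc ‖f (x + n • unitVec N μ + unitVec N μ) - f x‖
        = ‖(f (x + n • unitVec N μ + unitVec N μ) - f (x + n • unitVec N μ)) + (f (x + n • unitVec N μ) - f x)‖ := by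
          congr 1; abel
      _ ≤ lam + n * lam := (norm_add_le _ _).trans (add_le_add hstep ih)
      _ = (n + 1 : ℕ) * lam := by push_cast; ring

/-- the cube point `x₀ + Σ_μ v_μ • e_μ`. [folklore] -/
def cubePt (x₀ : Tor N) (v : Fin d → ℕ) : Tor N := x₀ + ∑ μ, v μ • unitVec N μ

omit hN in
/-- partial cube diagonals: `‖f (x₀ + Σ_{μ ∈ s} v_μ • e_μ) − f x₀‖ ≤ λ · Σ_{μ ∈ s} v_μ`. [folklore] -/
theorem norm_sub_partial_le (f : Tor N → E) {lam : ℝ} (hlip : ∀ (x : Tor N) (μ : Fin d), ‖f (x + unitVec N μ) - f x‖ ≤ lam)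
    (x₀ : Tor N) (v : Fin d → ℕ) (s : Finset (Fin d)) :
    ‖f (x₀ + ∑ μ ∈ s, v μ • unitVec N μ) - f x₀‖ ≤ lam * ∑ μ ∈ s, (v μ : ℝ) := by
  classical
  induction s using Finset.induction_on with
  | empty => simp
  | @insert μ s hμ ih =>
    rw [Finset.sum_insert hμ, Finset.sum_insert hμ, add_comm (v μ • unitVec N μ), ← add_assoc, mul_add]
    have hstep := norm_sub_le_of_nsmul_unitVec N f hlip (x₀ + ∑ μ ∈ s, v μ • unitVec N μ) μ (v μ)
    calc ‖f (x₀ + ∑ μ ∈ s, v μ • unitVec N μ + v μ • unitVec N μ) - f x₀‖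
        = ‖(f (x₀ + ∑ μ ∈ s, v μ • unitVec N μ + v μ • unitVec N μ) - f (x₀ + ∑ μ ∈ s, v μ • unitVec N μ))
            + (f (x₀ + ∑ μ ∈ s, v μ • unitVec N μ) - f x₀)‖ := by congr 1; abel
      _ ≤ (v μ : ℝ) * lam + lam * ∑ μ ∈ s, (v μ : ℝ) := (norm_add_le _ _).trans (add_le_add hstep ih)
      _ = lam * (v μ : ℝ) + lam * ∑ μ ∈ s, (v μ : ℝ) := by ring

omit hN in
/-- **THE CUBE DIAGONAL COSTS AT MOST `λ·Σ_μ v_μ`.** [folklore] -/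
theorem norm_sub_cubePt_le (f : Tor N → E) {lam : ℝ} (hlip : ∀ (x : Tor N) (μ : Fin d), ‖f (x + unitVec N μ) - f x‖ ≤ lam)
    (x₀ : Tor N) (v : Fin d → ℕ) : ‖f (cubePt N x₀ v) - f x₀‖ ≤ lam * ∑ μ, (v μ : ℝ) :=
  norm_sub_partial_le N f hlip x₀ v Finset.univ

/-! ## §2 The cube `[0, r]^d` embeds injectively in the torus when `r < N_μ` -/

omit hN in
/-- coordinates of a cube point: `(cubePt x₀ v) μ = x₀ μ + v μ`. [folklore] -/
theorem cubePt_apply (x₀ : Tor N) (v : Fin d → ℕ) (μ : Fin d) : cubePt N x₀ v μ = x₀ μ + (v μ : ZMod (N μ)) := by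
  classical
  rw [cubePt, Pi.add_apply, Finset.sum_apply]
  congr 1
  have h : ∀ ν, (v ν • unitVec N ν) μ = if ν = μ then ((v μ : ℕ) : ZMod (N μ)) else 0 := by
    intro ν
    rw [Pi.smul_apply, unitVec]
    by_cases hνμ : ν = μ
    · subst hνμ; rw [if_pos rfl, Pi.single_eq_same, nsmul_eq_mul, mul_one]
    · rw [if_neg hνμ, Pi.single_eq_of_ne (Ne.symm hνμ), smul_zero]
  simp_rw [h]
  rw [Finset.sum_ite_eq' Finset.univ μ]
  simp

omit hN in
/-- **INJECTIVITY OF THE CUBE**: for `r < N_μ` (all `μ`), `v ↦ cubePt x₀ v` is injective on `{v | ∀ μ, v μ ≤ r}`. [folklore] -/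
theorem cubePt_injOn (x₀ : Tor N) {r : ℕ} (hr : ∀ μ, r < N μ) :
    Set.InjOn (cubePt N x₀) {v : Fin d → ℕ | ∀ μ, v μ ≤ r} := by
  intro v hv v' hv' h
  funext μ
  have hμ := congr_fun h μ
  rw [cubePt_apply, cubePt_apply, add_right_inj] at hμ
  have h1 : v μ < N μ := lt_of_le_of_lt (hv μ) (hr μ)
  have h2 : v' μ < N μ := lt_of_le_of_lt (hv' μ) (hr μ)
  have := (ZMod.natCast_eq_natCast_iff' (v μ) (v' μ) (N μ)).1 hμ
  rwa [Nat.mod_eq_of_lt h1, Nat.mod_eq_of_lt h2] at this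

/-! ## §3 The interpolation inequality -/

/-- **`(r+1)^d · (‖f x₀‖ − d·r·λ)² ≤ Σ_x ‖f x‖²`** for every `r` with `r < N_μ` (all `μ`), `λ ≥ 0` and `d·r·λ ≤ ‖f x₀‖`: on the injectively embedded
cube `x₀ + [0, r]^d` every value has norm `≥ ‖f x₀‖ − d·r·λ` (cube diagonal), and the cube has `(r+1)^d` points. [folklore] -/
theorem card_mul_sq_le_sum_sq (f : Tor N → E) {lam : ℝ} (hlam : 0 ≤ lam)
    (hlip : ∀ (x : Tor N) (μ : Fin d), ‖f (x + unitVec N μ) - f x‖ ≤ lam)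
    (x₀ : Tor N) {r : ℕ} (hr : ∀ μ, r < N μ) (hm : (d : ℝ) * r * lam ≤ ‖f x₀‖) :
    ((r + 1 : ℕ) : ℝ) ^ d * (‖f x₀‖ - d * r * lam) ^ 2 ≤ ∑ x : Tor N, ‖f x‖ ^ 2 := by
  classical
  have hm0 : 0 ≤ ‖f x₀‖ - d * r * lam := sub_nonneg.mpr hm
  set B : Finset (Fin d → ℕ) := Fintype.piFinset fun _ : Fin d => Finset.range (r + 1) with hB
  have hBmem : ∀ v ∈ B, ∀ μ, v μ ≤ r := fun v hv μ =>
    Nat.lt_succ_iff.mp (Finset.mem_range.mp (Fintype.mem_piFinset.mp hv μ))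
  have hcard : B.card = (r + 1) ^ d := by
    rw [hB, Fintype.card_piFinset]
    simp [Finset.card_range, Finset.prod_const, Finset.card_univ, Fintype.card_fin]
  -- every cube value is at least `‖f x₀‖ − d·r·λ`
  have hval : ∀ v ∈ B, (‖f x₀‖ - d * r * lam) ^ 2 ≤ ‖f (cubePt N x₀ v)‖ ^ 2 := by
    intro v hv
    have hsum : (∑ μ, (v μ : ℝ)) ≤ d * r := by
      calc (∑ μ, (v μ : ℝ)) ≤ ∑ _μ : Fin d, (r : ℝ) := Finset.sum_le_sum fun μ _ => by exact_mod_cast hBmem v hv μ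
        _ = d * r := by simp [Finset.sum_const, Finset.card_univ, Fintype.card_fin]
    have h1 := norm_sub_cubePt_le N f hlip x₀ v
    have h2 := norm_sub_norm_le (f x₀) (f (cubePt N x₀ v))
    rw [← norm_sub_rev (f (cubePt N x₀ v)) (f x₀)] at h2
    have h3 : lam * ∑ μ, (v μ : ℝ) ≤ lam * (d * r) := mul_le_mul_of_nonneg_left hsum hlam
    have h4 : ‖f x₀‖ - d * r * lam ≤ ‖f (cubePt N x₀ v)‖ := by linarith
    exact pow_le_pow_left₀ hm0 h4 2
  have hinj : Set.InjOn (cubePt N x₀) ↑B := fun v hv v' hv' h =>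
    cubePt_injOn N x₀ hr (fun μ => hBmem v (Finset.mem_coe.mp hv) μ) (fun μ => hBmem v' (Finset.mem_coe.mp hv') μ) h
  calc ((r + 1 : ℕ) : ℝ) ^ d * (‖f x₀‖ - d * r * lam) ^ 2 = ∑ _v ∈ B, (‖f x₀‖ - d * r * lam) ^ 2 := by
        rw [Finset.sum_const, hcard, nsmul_eq_mul]; push_cast; ring
    _ ≤ ∑ v ∈ B, ‖f (cubePt N x₀ v)‖ ^ 2 := Finset.sum_le_sum hval
    _ = ∑ x ∈ B.image (cubePt N x₀), ‖f x‖ ^ 2 := (Finset.sum_image (f := fun x => ‖f x‖ ^ 2) hinj).symm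
    _ ≤ ∑ x, ‖f x‖ ^ 2 := Finset.sum_le_sum_of_subset_of_nonneg (Finset.subset_univ _) fun x _ _ => sq_nonneg _

/-- **THE ℓ² → SUP INTERPOLATION (two-term form)**: `‖f x₀‖ ≤ d·r·λ + √(Σ_x ‖f x‖²) / √((r+1)^d)` for EVERY `r` with `r < N_μ` (all `μ`) — a
step-Lipschitz field with small ℓ²-energy is small pointwise; the consumer optimises `r` (≈ `(√Σ/(dλ))^{2/(d+2)}`), recovering
`sup ≤ C_d·(λ^d·Σ‖f‖²)^{1/(d+2)}` up to the lattice cut-offs. [folklore] -/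
theorem norm_le_of_stepLipschitz_of_sum_sq (f : Tor N → E) {lam : ℝ} (hlam : 0 ≤ lam)
    (hlip : ∀ (x : Tor N) (μ : Fin d), ‖f (x + unitVec N μ) - f x‖ ≤ lam) (x₀ : Tor N) {r : ℕ} (hr : ∀ μ, r < N μ) :
    ‖f x₀‖ ≤ d * r * lam + Real.sqrt (∑ x : Tor N, ‖f x‖ ^ 2) / Real.sqrt (((r + 1 : ℕ) : ℝ) ^ d) := by
  have hpos : 0 < Real.sqrt (((r + 1 : ℕ) : ℝ) ^ d) := Real.sqrt_pos.mpr (by positivity)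
  by_cases hm : (d : ℝ) * r * lam ≤ ‖f x₀‖
  · have h := card_mul_sq_le_sum_sq N f hlam hlip x₀ hr hm
    have hm0 : 0 ≤ ‖f x₀‖ - d * r * lam := sub_nonneg.mpr hm
    have key : (‖f x₀‖ - d * r * lam) * Real.sqrt (((r + 1 : ℕ) : ℝ) ^ d) ≤ Real.sqrt (∑ x : Tor N, ‖f x‖ ^ 2) := by
      have e : (‖f x₀‖ - d * r * lam) * Real.sqrt (((r + 1 : ℕ) : ℝ) ^ d)
          = Real.sqrt ((‖f x₀‖ - d * r * lam) ^ 2 * ((r + 1 : ℕ) : ℝ) ^ d) := by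
        rw [Real.sqrt_mul (sq_nonneg _), Real.sqrt_sq hm0]
      rw [e]
      exact Real.sqrt_le_sqrt (by rw [mul_comm]; exact h)
    have h2 : ‖f x₀‖ - d * r * lam ≤ Real.sqrt (∑ x : Tor N, ‖f x‖ ^ 2) / Real.sqrt (((r + 1 : ℕ) : ℝ) ^ d) :=
      (le_div_iff₀ hpos).mpr key
    linarith
  · push Not at hm
    have : 0 ≤ Real.sqrt (∑ x : Tor N, ‖f x‖ ^ 2) / Real.sqrt (((r + 1 : ℕ) : ℝ) ^ d) := by positivity
    linarith

end Summit.QuantumFields.BalabanUV.T4Continuum.LatticeSupFromEnergy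

end
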